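import Summits.ABC.ABC.Theorems.TwistAmplificationMazurKaneLawRecordDefs
import Summits.ABC.ABC.Theorems.TwistAmplificationMazurKaneLawRecordLPR74
import Summits.ABC.ABC.Theorems.TwistAmplificationMazurKaneLawToolkitCertifiedLaw
import Literature.NumberTheory.DiophantineGeometry.AbcShapeLPInstance

-- Summit.ABC.ABC is the mandated summit-side namespace (single-conjunct summit); the lakefile sets the same option tree-wide.
set_option linter.dupNamespace false

/-!
# Record exponent `R74` for crux `TwistAmplification.MazurKaneLaw` (stmt-ABC-2757): the instance

Line `fibre-toolkit-lp-wall-map`, record pipeline step 2 (INSTANCE) at `(J, s₀, Vc) = (3, 7/4, 49/50)`: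
`Toolkit.RecordInstance 3 (7/4) (49/50)`. For shape data in dimension `3 + e` with the standing hypotheses of the
exponent dictionary, the determinant tool beyond `P₀` and the two square-root lattice tools, the exponents
`aⱼ = log_Λ X_{j-1}`, `bⱼ`, `cⱼ` (`j ≤ 3`, coordinates `Fin.castAdd e (j-1)`), `A = Σᵢ log_Λ Xᵢ`, `B`, `C`, the deficits
`d_a = 1 − log_Λ(c₁ · shapeVal X)`, `d_b`, `d_c`, `D = log_Λ B_d` and the slack `σ = recordSlack 3 (3+e) Λ Dτ P₀ t (7/4)`
(`Λ = 2C₀`) satisfy the 40 hypotheses of the generated LP lemma `lp_R74`, whence `log_Λ B_d ≤ 49/50 + σ`.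
The pattern is `AbcShapes.logb_shapeCount_le` (BBLT §6) with `3` explicit levels in place of `6`; the sixteen tools are
one determinant entry (`det_linear` at level `2`), three Fourier entries (`AbcShapes.fourier_linear`), eight subset
geometry-of-numbers entries (`AbcShapes.geometry_disjunction`) and four square-root lattice entries
(`sqrtLattice_linear`, hosts `x`, `y` (via `shapeCount_swap`), `z`).
-/

noncomputable section

open Finset
open Literature.NumberTheory.DiophantineGeometry
open Literature.NumberTheory.DiophantineGeometry.AbcShapes

namespace Summit.ABC.ABC.Theorems.MazurKaneLaw

open Summit.ABC.ABC.Theorems.MazurKaneLaw.Toolkit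

/-- `Σᵢ f i` over `Fin (3 + e)` dominates the first three terms when `f ≥ 0`. [folklore] -/
theorem three_le_sum {e : ℕ} {f : Fin (3 + e) → ℝ} (hf : ∀ i, 0 ≤ f i) :
    f (Fin.castAdd e 0) + f (Fin.castAdd e 1) + f (Fin.castAdd e 2) ≤ ∑ i, f i := by
  -- adapted from Literature/NumberTheory/DiophantineGeometry/AbcShapeLPInstance.lean (`six_le_sum`)
  rw [Fin.sum_univ_add, Fin.sum_univ_three]
  linarith [sum_nonneg fun (i : Fin e) (_ : i ∈ univ) => hf (Fin.natAdd 3 i)]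

/-- The weighted constraint `Σᵢ (i+1) f i ≤ L` gives `4 Σᵢ f i − L ≤ 3f₀ + 2f₁ + f₂` for `f ≥ 0` (the tail
`i ≥ 3` carries weight `≥ 4`). [folklore] -/
theorem four_mul_sum_sub_le {e : ℕ} {f : Fin (3 + e) → ℝ} {L : ℝ} (hf : ∀ i, 0 ≤ f i)
    (h : ∑ i : Fin (3 + e), ((i : ℕ) + 1 : ℝ) * f i ≤ L) :
    4 * ∑ i, f i - L ≤ 3 * f (Fin.castAdd e 0) + 2 * f (Fin.castAdd e 1) + f (Fin.castAdd e 2) := by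
  -- adapted from Literature/NumberTheory/DiophantineGeometry/AbcShapeLPInstance.lean (`seven_mul_sum_sub_one_le`)
  rw [Fin.sum_univ_add, Fin.sum_univ_three] at h ⊢
  simp only [Fin.val_castAdd, Fin.val_natAdd, Fin.coe_ofNat_eq_mod, Nat.reduceMod, Nat.cast_zero,
    Nat.cast_one, Nat.cast_ofNat] at h
  have htail : 4 * ∑ i : Fin e, f (Fin.natAdd 3 i) ≤
      ∑ i : Fin e, (((3 + (i : ℕ) : ℕ) : ℝ) + 1) * f (Fin.natAdd 3 i) := by
    rw [mul_sum]
    refine sum_le_sum fun i _ => mul_le_mul_of_nonneg_right ?_ (hf _)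
    have : (0 : ℝ) ≤ ((i : ℕ) : ℝ) := Nat.cast_nonneg _
    push_cast; linarith
  linarith

/-- The three structural facts of one term `W` with coefficient `c` and `c · shapeVal W ≤ Λ = 2C₀`: the deficit
`1 − log_Λ(c · shapeVal W)` lies in `[0, 1]`, and `4A − 3w₁ − 2w₂ − w₃ ≤ log_Λ(shapeVal W) ≤ log_Λ(c · shapeVal W)`
(`log_Λ shapeVal W = Σ (i+1) wᵢ`). [folklore] -/
theorem term_facts {e c C₀ : ℕ} (hc : 0 < c) {W : Fin (3 + e) → ℕ} (hW : ∀ i, 0 < W i) {Λ : ℝ} (hΛ : 1 < Λ)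
    (hΛC : Λ = 2 * C₀) (hv : c * shapeVal W ≤ 2 * C₀) :
    0 ≤ 1 - Real.logb Λ ((c * shapeVal W : ℕ) : ℝ) ∧ 1 - Real.logb Λ ((c * shapeVal W : ℕ) : ℝ) ≤ 1 ∧
      -3 * expo Λ W (Fin.castAdd e 0) - 2 * expo Λ W (Fin.castAdd e 1) - expo Λ W (Fin.castAdd e 2) +
          4 * ∑ i, expo Λ W i ≤ 1 - (1 - Real.logb Λ ((c * shapeVal W : ℕ) : ℝ)) := by
  have hcv : 0 < c * shapeVal W := Nat.mul_pos hc (shapeVal_pos hW)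
  have h1 : Real.logb Λ ((c * shapeVal W : ℕ) : ℝ) ≤ 1 := by
    calc Real.logb Λ ((c * shapeVal W : ℕ) : ℝ) ≤ Real.logb Λ ((2 * C₀ : ℕ) : ℝ) := logb_natMono hΛ hcv hv
      _ = 1 := by push_cast; rw [← hΛC]; exact Real.logb_self_eq_one hΛ
  have h0 : 0 ≤ Real.logb Λ ((c * shapeVal W : ℕ) : ℝ) :=
    Real.logb_nonneg hΛ (by exact_mod_cast Nat.one_le_iff_ne_zero.mpr hcv.ne')
  have hle : ∑ i : Fin (3 + e), ((i : ℕ) + 1 : ℝ) * expo Λ W i ≤ Real.logb Λ ((c * shapeVal W : ℕ) : ℝ) := by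
    rw [← logb_shapeVal hW]
    exact logb_natMono hΛ (shapeVal_pos hW) (Nat.le_mul_of_pos_left _ hc)
  have h4 := four_mul_sum_sub_le (expo_nonneg hΛ hW) hle
  exact ⟨by linarith, by linarith, by linarith⟩

/-- **Record instance `R74`: `RecordInstance 3 (7/4) (49/50)`.** With `Λ = 2C₀`, the exponents of the data satisfy the
hypotheses of `lp_R74` with the slack `σ = recordSlack 3 (3+e) Λ Dτ P₀ t (7/4)`: structure (`three_le_sum`,
`term_facts`, `C₀ ≤ V₂ c₃ shapeVal Z`, `∏ XᵢYᵢZᵢ ≤ Λ^t`), the determinant entry at level `2`, the Fourier entries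
`(2,2,3), (2,3,2), (3,2,2)`, eight geometry entries and four square-root lattice entries; every loss is `≤ σ`. [folklore] -/
theorem recordInstance_R74 : Summit.ABC.ABC.Theorems.MazurKaneLaw.Toolkit.RecordInstance 3 (7 / 4) (49 / 50) := by
  intro e c₁ c₂ c₃ C₀ hc₁ hc₂ hc₃ hC₀ X Y Z hX hY hZ T Dτ hTX hTY hTZ hD hC₀le hvX hvY hvZ t hP hB0 P₀ hP₀ hdet hQX
    hQZ hσm
  classical
  obtain ⟨Λ, hΛdef⟩ : ∃ Λ : ℝ, Λ = 2 * C₀ := ⟨_, rfl⟩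
  rw [← hΛdef] at hP hσm ⊢
  obtain ⟨σ, hσdef⟩ : ∃ σ : ℝ, recordSlack 3 (3 + e) Λ Dτ P₀ t (7 / 4) = σ := ⟨_, rfl⟩
  rw [hσdef] at hσm ⊢
  -- positivity of the scale and of the loss terms
  have hC₀' : (1 : ℝ) ≤ C₀ := by exact_mod_cast hC₀
  have hΛ : 1 < Λ := by rw [hΛdef]; linarith only [hC₀']
  have hΛ0 : 0 < Λ := by linarith only [hΛ]
  have hDτ : 1 ≤ Dτ := by
    have h1 : (1 : ℕ) ≤ T :=
      le_trans (Nat.mul_pos hc₃ (shapeVal_pos fun i => Nat.mul_pos two_pos (hZ i))) hTZ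
    simpa using hD 1 one_ne_zero h1
  have hBr : (0 : ℝ) < shapeCount c₁ c₂ c₃ X Y Z := by exact_mod_cast hB0
  have he0 : (0 : ℝ) ≤ (e : ℝ) := Nat.cast_nonneg _
  have hdd : ((3 + e : ℕ) : ℝ) = 3 + (e : ℝ) := by push_cast; ring
  have hlD0 : 0 ≤ Real.logb Λ Dτ := Real.logb_nonneg hΛ (by exact_mod_cast hDτ)
  have hl20 : 0 ≤ Real.logb Λ 2 := Real.logb_nonneg hΛ (by norm_num)
  have hV2pos : 0 < shapeVal (fun _ : Fin (3 + e) => 2) := shapeVal_pos fun _ => two_pos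
  have hlV0 : 0 ≤ Real.logb Λ ((shapeVal (fun _ : Fin (3 + e) => 2) : ℕ) : ℝ) :=
    Real.logb_nonneg hΛ (by exact_mod_cast Nat.one_le_iff_ne_zero.mpr hV2pos.ne')
  have hl27 : 0 ≤ Real.logb Λ 27 := Real.logb_nonneg hΛ (by norm_num)
  have hl48 : 0 ≤ Real.logb Λ 48 := Real.logb_nonneg hΛ (by norm_num)
  have hl114 : 0 ≤ Real.logb Λ 114 := Real.logb_nonneg hΛ (by norm_num)
  have hl288 : 0 ≤ Real.logb Λ 288 := Real.logb_nonneg hΛ (by norm_num)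
  have hlP0 : 0 ≤ Real.logb Λ P₀ := Real.logb_nonneg hΛ hP₀
  obtain ⟨m, hmdef⟩ : ∃ m : ℝ, max (t - 7 / 4) 0 = m := ⟨_, rfl⟩
  have hmax0 : 0 ≤ m := by rw [← hmdef]; exact le_max_right _ _
  have hmax1 : t - 7 / 4 ≤ m := by rw [← hmdef]; exact le_max_left _ _
  have hσ' : σ = (12 * (3 + (e : ℝ)) + 19) * Real.logb Λ Dτ + 22 * Real.logb Λ 2 +
      Real.logb Λ ((shapeVal (fun _ : Fin (3 + e) => 2) : ℕ) : ℝ) + Real.logb Λ 27 + Real.logb Λ 48 +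
      Real.logb Λ 114 + Real.logb Λ 288 + Real.logb Λ P₀ + m := by
    have h288 : (24 : ℝ) * 3 * (3 + 1) = 288 := by norm_num
    rw [← hσdef, recordSlack, hmdef]; push_cast; rw [h288]; ring
  have hDl0 : 0 ≤ (12 * (3 + (e : ℝ)) + 19) * Real.logb Λ Dτ := mul_nonneg (by linarith only [he0]) hlD0
  have hσ0 : 0 ≤ σ := by rw [hσ']; linarith only [hDl0, hl20, hlV0, hl27, hl48, hl114, hl288, hlP0, hmax0]
  -- the three special coordinates (levels `1, 2, 3`): distinctness and values
  have hne : ∀ {p q : Fin 3}, p ≠ q → (Fin.castAdd e p : Fin (3 + e)) ≠ Fin.castAdd e q :=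
    fun h h' => h (Fin.castAdd_injective _ _ h')
  have h01 := hne (show (0 : Fin 3) ≠ 1 by decide)
  have h02 := hne (show (0 : Fin 3) ≠ 2 by decide)
  have hv0 : ((Fin.castAdd e (0 : Fin 3) : Fin (3 + e)) : ℕ) = 0 := rfl
  have hv1 : ((Fin.castAdd e (1 : Fin 3) : Fin (3 + e)) : ℕ) = 1 := rfl
  have hv2 : ((Fin.castAdd e (2 : Fin 3) : Fin (3 + e)) : ℕ) = 2 := rfl
  have hv0r : (((Fin.castAdd e (0 : Fin 3) : Fin (3 + e)) : ℕ) : ℝ) = 0 := by rw [hv0, Nat.cast_zero]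
  have hv1r : (((Fin.castAdd e (1 : Fin 3) : Fin (3 + e)) : ℕ) : ℝ) = 1 := by rw [hv1, Nat.cast_one]
  have hv2r : (((Fin.castAdd e (2 : Fin 3) : Fin (3 + e)) : ℕ) : ℝ) = 2 := by rw [hv2, Nat.cast_ofNat]
  -- the LP variables: `A, B, C` (total exponents), `aⱼ, bⱼ, cⱼ` (levels `1, 2, 3`), `D`, the deficits `da, db, dc`
  have hα0 : ∀ i, 0 ≤ expo Λ X i := expo_nonneg hΛ hX
  have hβ0 : ∀ i, 0 ≤ expo Λ Y i := expo_nonneg hΛ hY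
  have hγ0 : ∀ i, 0 ≤ expo Λ Z i := expo_nonneg hΛ hZ
  obtain ⟨A, hA⟩ : ∃ r : ℝ, ∑ i, expo Λ X i = r := ⟨_, rfl⟩
  obtain ⟨B, hB⟩ : ∃ r : ℝ, ∑ i, expo Λ Y i = r := ⟨_, rfl⟩
  obtain ⟨C, hC⟩ : ∃ r : ℝ, ∑ i, expo Λ Z i = r := ⟨_, rfl⟩
  obtain ⟨a1, ha1⟩ : ∃ r : ℝ, expo Λ X (Fin.castAdd e 0) = r := ⟨_, rfl⟩
  obtain ⟨a2, ha2⟩ : ∃ r : ℝ, expo Λ X (Fin.castAdd e 1) = r := ⟨_, rfl⟩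
  obtain ⟨a3, ha3⟩ : ∃ r : ℝ, expo Λ X (Fin.castAdd e 2) = r := ⟨_, rfl⟩
  obtain ⟨b1, hb1⟩ : ∃ r : ℝ, expo Λ Y (Fin.castAdd e 0) = r := ⟨_, rfl⟩
  obtain ⟨b2, hb2⟩ : ∃ r : ℝ, expo Λ Y (Fin.castAdd e 1) = r := ⟨_, rfl⟩
  obtain ⟨b3, hb3⟩ : ∃ r : ℝ, expo Λ Y (Fin.castAdd e 2) = r := ⟨_, rfl⟩
  obtain ⟨c1, hc1⟩ : ∃ r : ℝ, expo Λ Z (Fin.castAdd e 0) = r := ⟨_, rfl⟩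
  obtain ⟨c2, hc2⟩ : ∃ r : ℝ, expo Λ Z (Fin.castAdd e 1) = r := ⟨_, rfl⟩
  obtain ⟨c3, hc3⟩ : ∃ r : ℝ, expo Λ Z (Fin.castAdd e 2) = r := ⟨_, rfl⟩
  obtain ⟨D, hDn⟩ : ∃ r : ℝ, Real.logb Λ (shapeCount c₁ c₂ c₃ X Y Z) = r := ⟨_, rfl⟩
  obtain ⟨da, hda⟩ : ∃ r : ℝ, 1 - Real.logb Λ ((c₁ * shapeVal X : ℕ) : ℝ) = r := ⟨_, rfl⟩
  obtain ⟨db, hdb⟩ : ∃ r : ℝ, 1 - Real.logb Λ ((c₂ * shapeVal Y : ℕ) : ℝ) = r := ⟨_, rfl⟩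
  obtain ⟨dc, hdc⟩ : ∃ r : ℝ, 1 - Real.logb Λ ((c₃ * shapeVal Z : ℕ) : ℝ) = r := ⟨_, rfl⟩
  have hLX : Real.logb Λ ((c₁ * shapeVal X : ℕ) : ℝ) = 1 - da := by rw [← hda]; ring
  have hLY : Real.logb Λ ((c₂ * shapeVal Y : ℕ) : ℝ) = 1 - db := by rw [← hdb]; ring
  have hLZ : Real.logb Λ ((c₃ * shapeVal Z : ℕ) : ℝ) = 1 - dc := by rw [← hdc]; ring
  have hLrad : radExp Λ X Y Z = A + B + C := by rw [radExp, sum_add_distrib, sum_add_distrib, hA, hB, hC]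
  have hdefic : deficiency Λ c₁ c₂ c₃ X Y Z = da + db + dc := by rw [deficiency, ← hda, ← hdb, ← hdc]; ring
  /- structure: non-negativity, `a1 + a2 + a3 ≤ A`, the weighted constraints and the deficits -/
  have hna1 : 0 ≤ a1 := by rw [← ha1]; exact hα0 _
  have hna2 : 0 ≤ a2 := by rw [← ha2]; exact hα0 _
  have hna3 : 0 ≤ a3 := by rw [← ha3]; exact hα0 _
  have hnb1 : 0 ≤ b1 := by rw [← hb1]; exact hβ0 _
  have hnb2 : 0 ≤ b2 := by rw [← hb2]; exact hβ0 _
  have hnb3 : 0 ≤ b3 := by rw [← hb3]; exact hβ0 _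
  have hnc1 : 0 ≤ c1 := by rw [← hc1]; exact hγ0 _
  have hnc2 : 0 ≤ c2 := by rw [← hc2]; exact hγ0 _
  have hnc3 : 0 ≤ c3 := by rw [← hc3]; exact hγ0 _
  have hTa : (a1 + a2 + a3) ≤ A := by rw [← ha1, ← ha2, ← ha3, ← hA]; exact three_le_sum hα0
  have hTb : (b1 + b2 + b3) ≤ B := by rw [← hb1, ← hb2, ← hb3, ← hB]; exact three_le_sum hβ0
  have hTc : (c1 + c2 + c3) ≤ C := by rw [← hc1, ← hc2, ← hc3, ← hC]; exact three_le_sum hγ0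
  obtain ⟨hda0, hda1, hWa⟩ := term_facts hc₁ hX hΛ hΛdef hvX
  obtain ⟨hdb0, hdb1, hWb⟩ := term_facts hc₂ hY hΛ hΛdef hvY
  obtain ⟨hdc0, -, hWc⟩ := term_facts hc₃ hZ hΛ hΛdef hvZ
  rw [hda] at hda0 hda1
  rw [hda, ha1, ha2, ha3, hA] at hWa
  rw [hdb] at hdb0 hdb1
  rw [hdb, hb1, hb2, hb3, hB] at hWb
  rw [hdc] at hdc0
  rw [hdc, hc1, hc2, hc3, hC] at hWc
  -- `dc ≤ σ`: `C₀ ≤ V₂ · c₃ shapeVal Z` and `log_Λ C₀ = 1 − log_Λ 2`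
  have hdcσ : dc ≤ σ := by
    have h3 : Real.logb Λ (C₀ : ℝ) ≤ Real.logb Λ ((shapeVal (fun _ : Fin (3 + e) => 2) : ℕ) : ℝ) +
        Real.logb Λ ((c₃ * shapeVal Z : ℕ) : ℝ) := by
      rw [← logb_natMul hV2pos (Nat.mul_pos hc₃ (shapeVal_pos hZ))]
      exact logb_natMono hΛ (by omega) hC₀le
    have h4 : Real.logb Λ (C₀ : ℝ) = 1 - Real.logb Λ 2 := by
      have : (C₀ : ℝ) = Λ / 2 := by rw [hΛdef]; ring
      rw [this, Real.logb_div hΛ0.ne' two_ne_zero, Real.logb_self_eq_one hΛ]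
    rw [hLZ] at h3
    linarith only [h3, h4, hσ', hDl0, hl20, hlV0, hl27, hl48, hl114, hl288, hlP0, hmax0]
  /- the radical: `A + B + C = log_Λ ∏ XᵢYᵢZᵢ ≤ t ≤ 7/4 + (t − 7/4)₊` -/
  have hL : A + B + C ≤ (7 / 4 : ℝ) + σ := by
    have hNX : 0 < (dyadicBox X).card := by rw [card_dyadicBox]; exact prod_pos fun i _ => hX i
    have hNY : 0 < (dyadicBox Y).card := by rw [card_dyadicBox]; exact prod_pos fun i _ => hY i
    have hNZ : 0 < (dyadicBox Z).card := by rw [card_dyadicBox]; exact prod_pos fun i _ => hZ i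
    have hPeq : (((dyadicBox X).card * (dyadicBox Y).card * (dyadicBox Z).card : ℕ) : ℝ) =
        ∏ i, ((X i : ℝ) * Y i * Z i) := by
      rw [card_dyadicBox, card_dyadicBox, card_dyadicBox]; push_cast
      rw [← prod_mul_distrib, ← prod_mul_distrib]
    have hpos : (0 : ℝ) < (((dyadicBox X).card * (dyadicBox Y).card * (dyadicBox Z).card : ℕ) : ℝ) := by
      exact_mod_cast Nat.mul_pos (Nat.mul_pos hNX hNY) hNZ
    have hlog : Real.logb Λ (((dyadicBox X).card * (dyadicBox Y).card * (dyadicBox Z).card : ℕ) : ℝ)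
        ≤ t := by
      calc Real.logb Λ (((dyadicBox X).card * (dyadicBox Y).card * (dyadicBox Z).card : ℕ) : ℝ)
            ≤ Real.logb Λ (Λ ^ t) := Real.logb_le_logb_of_le hΛ hpos (by rw [hPeq]; exact hP)
        _ = t := Real.logb_rpow hΛ0 hΛ.ne'
    rw [logb_natMul (Nat.mul_pos hNX hNY) hNZ, logb_natMul hNX hNY, logb_card_dyadicBox hX,
      logb_card_dyadicBox hY, logb_card_dyadicBox hZ, hA, hB, hC] at hlog
    linarith only [hlog, hmax1, hσ', hDl0, hl20, hlV0, hl27, hl48, hl114, hl288, hlP0]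
  /- the determinant entry at level `2` (coordinate `1`) -/
  have h_Dt_2 : D ≤ (-a2 - b2 - c2 + A + B + C) + σ ∨
      D ≤ (A + B + C + (1 / 3 : ℝ) * da + (1 / 3 : ℝ) * db + (1 / 3 : ℝ) * dc - (1 : ℝ)) + σ := by
    have h := det_linear hc₁ hc₂ hc₃ hX hY hZ hDτ hΛ hB0 (Fin.castAdd e 1) (hdet (Fin.castAdd e 1) hv1.ge)
    have h144 : (24 : ℝ) * ((1 + 1) * (1 + 2)) = 144 := by norm_num
    have h9e : (3 : ℝ) * 1 + 6 = 9 := by norm_num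
    have h0e : (1 : ℝ) - 1 = 0 := by norm_num
    rw [hLrad, hdefic, hv1r, hDn, ha2, hb2, hc2, h144, h9e, h0e, zero_mul, zero_add] at h
    have hl144 : Real.logb Λ 144 ≤ Real.logb Λ 288 := Real.logb_le_logb_of_le hΛ (by norm_num) (by norm_num)
    have h9 : 9 * Real.logb Λ Dτ ≤ (12 * (3 + (e : ℝ)) + 19) * Real.logb Λ Dτ :=
      mul_le_mul_of_nonneg_right (by linarith only [he0]) hlD0
    rcases h with h | h
    · exact Or.inl (by linarith only [h, h9, hl144, hσ', hl20, hlV0, hl27, hl48, hl114, hlP0, hmax0])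
    · exact Or.inr (by linarith only [h, h9, hl144, hσ', hl20, hlV0, hl27, hl48, hl114, hlP0, hmax0])
  /- the Fourier entries `(e_U, e_V, e_W) = (2,2,3), (2,3,2), (3,2,2)` (saved sets: level `2` resp. `3`) -/
  have hfou : ∀ (SU SV SW : Finset (Fin (3 + e))) {eU eV eW : ℕ}, 2 ≤ eU → 2 ≤ eV → 2 ≤ eW →
      (∀ i ∈ SU, eU ∣ (i : ℕ) + 1) → (∀ i ∈ SV, eV ∣ (i : ℕ) + 1) → (∀ i ∈ SW, eW ∣ (i : ℕ) + 1) →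
      ∑ i ∈ SU, expo Λ X i + ∑ i ∈ SV, expo Λ Y i + ∑ i ∈ SW, expo Λ Z i ≤
        4 * (∑ i, expo Λ X i + ∑ i, expo Λ Y i + ∑ i, expo Λ Z i) -
          6 * Real.logb Λ (shapeCount c₁ c₂ c₃ X Y Z) + σ := by
    intro SU SV SW eU eV eW heU heV heW hSU hSV hSW
    have h := fourier_linear hc₁ hc₂ hc₃ hX hY hZ hTX hTY hTZ hD hΛ hB0 SU SV SW heU heV heW hSU hSV hSW
    have h16 : (12 * (3 + (e : ℝ)) + 3) * Real.logb Λ Dτ ≤ (12 * (3 + (e : ℝ)) + 19) * Real.logb Λ Dτ :=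
      mul_le_mul_of_nonneg_right (by linarith only [he0]) hlD0
    rw [hdd] at h
    linarith only [h, h16, hσ', hl20, hlV0, hl48, hl114, hl288, hlP0, hmax0]
  have dv2 : ∀ i ∈ ({Fin.castAdd e 1} : Finset (Fin (3 + e))), 2 ∣ (i : ℕ) + 1 := by
    intro i hi; rw [mem_singleton] at hi; subst hi; exact ⟨1, rfl⟩
  have dv3 : ∀ i ∈ ({Fin.castAdd e 2} : Finset (Fin (3 + e))), 3 ∣ (i : ℕ) + 1 := by
    intro i hi; rw [mem_singleton] at hi; subst hi; exact ⟨1, rfl⟩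
  have h_F_223 : (a2 + b2 + c3) ≤ 4 * (A + B + C) - 6 * D + σ := by
    have f := hfou {Fin.castAdd e 1} {Fin.castAdd e 1} {Fin.castAdd e 2} le_rfl le_rfl (by norm_num) dv2 dv2 dv3
    rw [sum_singleton, sum_singleton, sum_singleton, hA, hB, hC, hDn, ha2, hb2, hc3] at f
    linarith only [f]
  have h_F_232 : (a2 + b3 + c2) ≤ 4 * (A + B + C) - 6 * D + σ := by
    have f := hfou {Fin.castAdd e 1} {Fin.castAdd e 2} {Fin.castAdd e 1} le_rfl (by norm_num) le_rfl dv2 dv3 dv2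
    rw [sum_singleton, sum_singleton, sum_singleton, hA, hB, hC, hDn, ha2, hb3, hc2] at f
    linarith only [f]
  have h_F_322 : (a3 + b2 + c2) ≤ 4 * (A + B + C) - 6 * D + σ := by
    have f := hfou {Fin.castAdd e 2} {Fin.castAdd e 1} {Fin.castAdd e 1} (by norm_num) le_rfl le_rfl dv3 dv2 dv2
    rw [sum_singleton, sum_singleton, sum_singleton, hA, hB, hC, hDn, ha3, hb2, hc2] at f
    linarith only [f]
  /- the subset geometry-of-numbers entries (index sets inside the first three coordinates) -/
  have hgeo : ∀ (I J K : Finset (Fin (3 + e))),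
      (8 + ∑ i ∈ I, ((i : ℕ) + 1 : ℝ) + ∑ i ∈ J, ((i : ℕ) + 1 : ℝ)) ≤ 22 →
      (∑ i ∈ I, expo Λ X i + ∑ i ∈ J, expo Λ Y i + ∑ i ∈ K, expo Λ Z i ≤
        (∑ i, expo Λ X i + ∑ i, expo Λ Y i + ∑ i, expo Λ Z i) -
          Real.logb Λ (shapeCount c₁ c₂ c₃ X Y Z) + σ) ∨
      (1 - (∑ i ∈ I, (i : ℝ) * expo Λ X i + ∑ i ∈ J, (i : ℝ) * expo Λ Y i +
          ∑ i ∈ K, (i : ℝ) * expo Λ Z i) ≤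
        (∑ i, expo Λ X i + ∑ i, expo Λ Y i + ∑ i, expo Λ Z i) -
          Real.logb Λ (shapeCount c₁ c₂ c₃ X Y Z) + σ) := by
    intro I J K hIJ
    refine geometry_disjunction hc₁ hc₂ hc₃ hX hY hZ hTX hTY hTZ hD hΛ hB0 hC₀ hΛdef hC₀le I J K ?_
    have h22 : (8 + ∑ i ∈ I, ((i : ℕ) + 1 : ℝ) + ∑ i ∈ J, ((i : ℕ) + 1 : ℝ)) * Real.logb Λ 2 ≤
        22 * Real.logb Λ 2 := mul_le_mul_of_nonneg_right hIJ hl20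
    have h3d : 3 * (3 + (e : ℝ)) * Real.logb Λ Dτ ≤ (12 * (3 + (e : ℝ)) + 19) * Real.logb Λ Dτ :=
      mul_le_mul_of_nonneg_right (by linarith only [he0]) hlD0
    rw [hdd]
    linarith only [h22, h3d, hσ', hl27, hl48, hl114, hl288, hlP0, hmax0]
  have h_G_a1a2b1c1 : (a1 + a2 + b1 + c1) ≤ (A + B + C) - D + σ ∨ 1 - (a2) ≤ (A + B + C) - D + σ := by
    have g := hgeo {Fin.castAdd e 0, Fin.castAdd e 1} {Fin.castAdd e 0} {Fin.castAdd e 0}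
      (by rw [sum_pair h01, sum_singleton, hv0r, hv1r]; norm_num)
    simp only [sum_pair h01, sum_singleton] at g
    rw [hv0r, hv1r, hA, hB, hC, hDn, ha1, ha2, hb1, hc1] at g
    rcases g with g | g
    · exact Or.inl (by linarith only [g])
    · exact Or.inr (by linarith only [g])
  have h_G_a1a3b1c1 : (a1 + a3 + b1 + c1) ≤ (A + B + C) - D + σ ∨ 1 - (2 * a3) ≤ (A + B + C) - D + σ := by
    have g := hgeo {Fin.castAdd e 0, Fin.castAdd e 2} {Fin.castAdd e 0} {Fin.castAdd e 0}
      (by rw [sum_pair h02, sum_singleton, hv0r, hv2r]; norm_num)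
    simp only [sum_pair h02, sum_singleton] at g
    rw [hv0r, hv2r, hA, hB, hC, hDn, ha1, ha3, hb1, hc1] at g
    rcases g with g | g
    · exact Or.inl (by linarith only [g])
    · exact Or.inr (by linarith only [g])
  have h_G_a1a3b1c1c3 : (a1 + a3 + b1 + c1 + c3) ≤ (A + B + C) - D + σ ∨
      1 - (2 * a3 + 2 * c3) ≤ (A + B + C) - D + σ := by
    have g := hgeo {Fin.castAdd e 0, Fin.castAdd e 2} {Fin.castAdd e 0} {Fin.castAdd e 0, Fin.castAdd e 2}
      (by rw [sum_pair h02, sum_singleton, hv0r, hv2r]; norm_num)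
    simp only [sum_pair h02, sum_singleton] at g
    rw [hv0r, hv2r, hA, hB, hC, hDn, ha1, ha3, hb1, hc1, hc3] at g
    rcases g with g | g
    · exact Or.inl (by linarith only [g])
    · exact Or.inr (by linarith only [g])
  have h_G_a1b1b2c1 : (a1 + b1 + b2 + c1) ≤ (A + B + C) - D + σ ∨ 1 - (b2) ≤ (A + B + C) - D + σ := by
    have g := hgeo {Fin.castAdd e 0} {Fin.castAdd e 0, Fin.castAdd e 1} {Fin.castAdd e 0}
      (by rw [sum_pair h01, sum_singleton, hv0r, hv1r]; norm_num)
    simp only [sum_pair h01, sum_singleton] at g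
    rw [hv0r, hv1r, hA, hB, hC, hDn, ha1, hb1, hb2, hc1] at g
    rcases g with g | g
    · exact Or.inl (by linarith only [g])
    · exact Or.inr (by linarith only [g])
  have h_G_a1b1b3c1 : (a1 + b1 + b3 + c1) ≤ (A + B + C) - D + σ ∨ 1 - (2 * b3) ≤ (A + B + C) - D + σ := by
    have g := hgeo {Fin.castAdd e 0} {Fin.castAdd e 0, Fin.castAdd e 2} {Fin.castAdd e 0}
      (by rw [sum_pair h02, sum_singleton, hv0r, hv2r]; norm_num)
    simp only [sum_pair h02, sum_singleton] at g
    rw [hv0r, hv2r, hA, hB, hC, hDn, ha1, hb1, hb3, hc1] at g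
    rcases g with g | g
    · exact Or.inl (by linarith only [g])
    · exact Or.inr (by linarith only [g])
  have h_G_a1b1c1 : (a1 + b1 + c1) ≤ (A + B + C) - D + σ ∨ 1 - (0 : ℝ) ≤ (A + B + C) - D + σ := by
    have g := hgeo {Fin.castAdd e 0} {Fin.castAdd e 0} {Fin.castAdd e 0}
      (by rw [sum_singleton, hv0r]; norm_num)
    simp only [sum_singleton] at g
    rw [hv0r, hA, hB, hC, hDn, ha1, hb1, hc1] at g
    rcases g with g | g
    · exact Or.inl (by linarith only [g])
    · exact Or.inr (by linarith only [g])
  have h_G_a1b1c1c2 : (a1 + b1 + c1 + c2) ≤ (A + B + C) - D + σ ∨ 1 - (c2) ≤ (A + B + C) - D + σ := by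
    have g := hgeo {Fin.castAdd e 0} {Fin.castAdd e 0} {Fin.castAdd e 0, Fin.castAdd e 1}
      (by rw [sum_singleton, hv0r]; norm_num)
    simp only [sum_pair h01, sum_singleton] at g
    rw [hv0r, hv1r, hA, hB, hC, hDn, ha1, hb1, hc1, hc2] at g
    rcases g with g | g
    · exact Or.inl (by linarith only [g])
    · exact Or.inr (by linarith only [g])
  have h_G_a1b1c1c3 : (a1 + b1 + c1 + c3) ≤ (A + B + C) - D + σ ∨ 1 - (2 * c3) ≤ (A + B + C) - D + σ := by
    have g := hgeo {Fin.castAdd e 0} {Fin.castAdd e 0} {Fin.castAdd e 0, Fin.castAdd e 2}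
      (by rw [sum_singleton, hv0r]; norm_num)
    simp only [sum_pair h02, sum_singleton] at g
    rw [hv0r, hv2r, hA, hB, hC, hDn, ha1, hb1, hc1, hc3] at g
    rcases g with g | g
    · exact Or.inl (by linarith only [g])
    · exact Or.inr (by linarith only [g])
  /- the square-root lattice entries at level `k = 2` (coordinate `1`): hosts `x` (`H = {0}`), `y` (`H = {0, 2}` and
  `H = {0}`, the `x`-tool on the swapped datum) and `z` (`H = {0}`) -/
  have hQσ : ∀ {Bc L1 L2 : ℝ},
      (Bc ≤ L1 + ((((3 + e : ℕ) : ℝ) + ((Fin.castAdd e (1 : Fin 3) : Fin (3 + e)) : ℕ) + 2) * Real.logb Λ Dτ +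
          Real.logb Λ 114) ∨
        Bc ≤ L2 + ((((3 + e : ℕ) : ℝ) + ((Fin.castAdd e (1 : Fin 3) : Fin (3 + e)) : ℕ) + 2) * Real.logb Λ Dτ +
          Real.logb Λ 114)) → Bc ≤ L1 + σ ∨ Bc ≤ L2 + σ := by
    intro Bc L1 L2 h
    have h6 : (3 + (e : ℝ) + 1 + 2) * Real.logb Λ Dτ ≤ (12 * (3 + (e : ℝ)) + 19) * Real.logb Λ Dτ :=
      mul_le_mul_of_nonneg_right (by linarith only [he0]) hlD0
    rw [hdd, hv1r] at h
    rcases h with h | h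
    · exact Or.inl (by linarith only [h, h6, hσ', hl20, hlV0, hl27, hl48, hl288, hlP0, hmax0])
    · exact Or.inr (by linarith only [h, h6, hσ', hl20, hlV0, hl27, hl48, hl288, hlP0, hmax0])
  have h_Q_a_1_2 : D ≤ (A + B + C + da - (1 : ℝ)) + σ ∨ D ≤ (-a1 - b2 - c2 + A + B + C) + σ := by
    have q := hQσ (sqrtLattice_linear hc₁ hX hY hZ hDτ hΛ hBr {Fin.castAdd e 0} (Fin.castAdd e 1)
      (hQX hc₁ hc₂ hc₃ X Y Z hX hY hZ hTX hTY hTZ hD {Fin.castAdd e 0} (Fin.castAdd e 1) hv1.ge))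
    rw [sum_singleton, sum_singleton, hv0r, hA, hB, hC, hDn, hLX, ha1, hb2, hc2] at q
    rcases q with q | q
    · exact Or.inl (by linarith only [q])
    · exact Or.inr (by linarith only [q])
  have hBr' : (0 : ℝ) < shapeCount c₂ c₁ c₃ Y X Z := by rw [← shapeCount_swap c₁ c₂ c₃ X Y Z]; exact hBr
  have h_Q_b_13_2 : D ≤ (2 * b3 + A + B + C + db - (1 : ℝ)) + σ ∨ D ≤ (-a2 - b1 - b3 - c2 + A + B + C) + σ := by
    have q := hQσ (sqrtLattice_linear hc₂ hY hX hZ hDτ hΛ hBr' {Fin.castAdd e 0, Fin.castAdd e 2}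
      (Fin.castAdd e 1) (hQX hc₂ hc₁ hc₃ Y X Z hY hX hZ hTY hTX hTZ hD {Fin.castAdd e 0, Fin.castAdd e 2}
        (Fin.castAdd e 1) hv1.ge))
    rw [← shapeCount_swap c₁ c₂ c₃ X Y Z, sum_pair h02, sum_pair h02, hv0r, hv2r, hA, hB, hC, hDn, hLY, ha2,
      hb1, hb3, hc2] at q
    rcases q with q | q
    · exact Or.inl (by linarith only [q])
    · exact Or.inr (by linarith only [q])
  have h_Q_b_1_2 : D ≤ (A + B + C + db - (1 : ℝ)) + σ ∨ D ≤ (-a2 - b1 - c2 + A + B + C) + σ := by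
    have q := hQσ (sqrtLattice_linear hc₂ hY hX hZ hDτ hΛ hBr' {Fin.castAdd e 0} (Fin.castAdd e 1)
      (hQX hc₂ hc₁ hc₃ Y X Z hY hX hZ hTY hTX hTZ hD {Fin.castAdd e 0} (Fin.castAdd e 1) hv1.ge))
    rw [← shapeCount_swap c₁ c₂ c₃ X Y Z, sum_singleton, sum_singleton, hv0r, hA, hB, hC, hDn, hLY, ha2, hb1,
      hc2] at q
    rcases q with q | q
    · exact Or.inl (by linarith only [q])
    · exact Or.inr (by linarith only [q])
  have h_Q_c_1_2 : D ≤ (A + B + C + dc - (1 : ℝ)) + σ ∨ D ≤ (-a2 - b2 - c1 + A + B + C) + σ := by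
    have hq' := hQZ hc₁ hc₂ hc₃ X Y Z hX hY hZ hTX hTY hTZ hD {Fin.castAdd e 0} (Fin.castAdd e 1) hv1.ge
    rw [← mul_rotate (subBox ({Fin.castAdd e 0} : Finset (Fin (3 + e))) Z).card] at hq'
    have q := hQσ (sqrtLattice_linear hc₃ hZ hX hY hDτ hΛ hBr {Fin.castAdd e 0} (Fin.castAdd e 1) hq')
    rw [sum_singleton, sum_singleton, hv0r, hA, hB, hC, hDn, hLZ, hc1, ha2, hb2] at q
    rcases q with q | q
    · exact Or.inl (by linarith only [q])
    · exact Or.inr (by linarith only [q])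
  /- the linear programme -/
  have key : D ≤ (49 / 50 : ℝ) + σ :=
    lp_R74 hna1 hna2 hna3 hnb1 hnb2 hnb3 hnc1 hnc2 hnc3 hTa hTb hTc hWa hda0 hda1 hWb hdb0 hdb1 hWc hdc0 hdcσ
      hσ0 hσm hL h_Dt_2 h_F_223 h_F_232 h_F_322 h_G_a1a2b1c1 h_G_a1a3b1c1 h_G_a1a3b1c1c3 h_G_a1b1b2c1
      h_G_a1b1b3c1 h_G_a1b1c1 h_G_a1b1c1c2 h_G_a1b1c1c3 h_Q_a_1_2 h_Q_b_13_2 h_Q_b_1_2 h_Q_c_1_2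
  rw [hDn]
  exact key

end Summit.ABC.ABC.Theorems.MazurKaneLaw

end
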